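import Literature.NumberTheory.LFunctions.ChebyshevPsiExplicitPartialRH
import Literature.NumberTheory.LFunctions.ZetaZeroTailSums
import Literature.NumberTheory.LFunctions.RiemannHypothesisUpTo2516
import Literature.NumberTheory.LFunctions.FordZetaZeroRecipSqSum
import Literature.NumberTheory.LFunctions.RosserSchoenfeldMertensFirstConstant
import Mathlib.NumberTheory.AbelSummation
import HarnessLib

/-!
# Stub `stub_mertensE1` (line `Sketch`, plan id A2 "MertensConst"): `|E₁(x)| ≤ 1/40` for `x ≥ 442439`

Crux `WeilComb.CombShapePositivity` (item stmt-RiemannHypothesis-11229), line `Sketch`, wave 1 of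
lead c3. The Perron-pivot Schur complement attacking the residual `stub_windowCore` has as its only
prime input the Mertens remainder `E₁(x) = ψ₁(x) − log x + γ`, `ψ₁(x) = Σ_{n ≤ x} Λ(n)/n`; this
file proves, in the line's namespace `…Theorems.WeilCombBohrFejer` and with the registered
constant `1/40`, the hypothesis-free large-`x` bound

* `stub_mertensE1` — `|Σ_{n ≤ x} Λ(n)/n − log x + γ| ≤ 1/40` for all real `x ≥ 442439`.

Ingredients (all in-tree): Abel summation `ψ₁(x) = ψ(x)/x + ∫_1^x ψ(t)t⁻² dt` and
`∫_1^∞ (ψ − t)t⁻² = −1 − γ` (`RosserSchoenfeld.integral_Ioi_psi_sub_self_div_sq`) give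
`E₁(x) = (ψ(x) − x)/x − ∫_x^∞ (ψ(t) − t) t⁻² dt`; then
`|ψ(x) − x| ≤ 0.00862x + 5.72√x + 1.838` (`PsiFromZeros2516.abs_psi_sub_self_le`, the 2000
certified zeros below height `2516`), Rosser–Schoenfeld's Lemma 7
(`PsiTailIntegral.abs_integral_Ioi_psi_sub_self_div_sq_le`, `rsK_le_of_inStripUpTo` with
`riemannHypothesisInStripUpTo_2516`), Ford's `Σ_ρ m(ρ)/|ρ|² ≤ 0.0463`
(`sum_zeroOrder_div_norm_sq_le`) and the zero-tail bound `ZetaZeroTails.tailInvNormProd_le`,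
`Gtail_le`: numerically `|E₁(x)| ≤ 0.00862 + 5.7663/665 + 3.68/442439 + 0.34·8/2516 < 0.0185`.

* `mertensE1_eq_boundary_sub_tail_w1a2` — the remainder form of the Abel identity (`x > 1`);
* `abs_mertensE1_le_explicit_w1a2` — the explicit five-term bound for `x ≥ 9`.

The same mechanism, with the constant `1/50` and in the namespace `…Theorems.WeilCombMertensE1`,
is in the tree's `WeilCombCombShapePositivityMertensE1.lean` (STUB-PLAN `stub_windowCore`, helper
A2); this file serves the registered `1/40` signature of line `Sketch` in `…Theorems.WeilCombBohrFejer`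
and imports only `Literature` modules. Like its inputs `ChebyshevPsiExplicitPartialRH.lean` /
`SchoenfeldZerosLow.lean`, everything from `abs_mertensE1_le_explicit_w1a2` on depends on the tree's
certified Odlyzko–te Riele computation of the first 2000 zeros (`MertensCertificate`,
`native_decide`, declared computational at the gate); no `native_decide` is used here.
-/

noncomputable section

-- the sub-problem path RiemannHypothesis/RiemannHypothesis duplicates a namespace (D-0017)
set_option linter.dupNamespace false

open MeasureTheory Set Filter ArithmeticFunction
open scoped Chebyshev Real

namespace Summit.RiemannHypothesis.RiemannHypothesis.Theorems.WeilCombBohrFejer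

open Literature.NumberTheory.LFunctions

/-- Abel summation for `Λ(n)/n`, remainder form: for real `x > 1`,
`Σ_{n ≤ x} Λ(n)/n − log x + γ = (ψ(x) − x)/x − ∫_x^∞ (ψ(t) − t) t⁻² dt`
(`Σ_{n ≤ x} Λ(n)/n = ψ(x)/x + ∫_1^x ψ(t)t⁻² dt`, `∫_1^x dt/t = log x`,
`∫_1^∞ (ψ − t)t⁻² dt = −1 − γ`). [cite: RosserSchoenfeld1962, (4.21) (the `ψ`-analogue)] -/
theorem mertensE1_eq_boundary_sub_tail_w1a2 {x : ℝ} (hx : 1 < x) :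
    (∑ n ∈ Finset.Icc 1 ⌊x⌋₊, (Λ n : ℝ) / n) - Real.log x + Real.eulerMascheroniConstant =
      (ψ x - x) / x - ∫ t in Ioi x, (ψ t - t) / t ^ 2 := by
  have hx0 : 0 < x := by linarith
  -- Abel summation with `c = Λ`, `f(t) = 1/t` on `[0, x]` (Mathlib's `sum_mul_eq_sub_integral_mul₀`)
  set c : ℕ → ℝ := fun k => (Λ k : ℝ) with hc
  set f : ℝ → ℝ := fun t => t⁻¹ with hf
  have hS : ∀ t : ℝ, ∑ k ∈ Finset.Icc 0 ⌊t⌋₊, c k = ψ t := fun t ↦ by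
    rw [Chebyshev.psi_eq_sum_Icc]
  have hf_diff : ∀ t ∈ Set.Icc 1 x, DifferentiableAt ℝ f t := fun t ht =>
    (hasDerivAt_inv (show t ≠ 0 by linarith [ht.1])).differentiableAt
  have hderiv_eq : ∀ t ∈ Set.Icc 1 x, deriv f t = -(t ^ 2)⁻¹ := fun t _ => by
    rw [hf, deriv_inv]
  have hg_cont : ContinuousOn (fun t : ℝ ↦ -(t ^ 2)⁻¹) (Set.Icc 1 x) :=
    ((continuousOn_pow 2 : ContinuousOn (fun t : ℝ ↦ t ^ 2) (Set.Icc 1 x)).inv₀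
      fun t (ht : t ∈ Set.Icc 1 x) => pow_ne_zero _ (show t ≠ 0 by linarith [ht.1])).neg
  have hf_int : IntegrableOn (deriv f) (Set.Icc 1 x) :=
    hg_cont.integrableOn_Icc.congr_fun (fun t ht => (hderiv_eq t ht).symm) measurableSet_Icc
  have hc0 : c 0 = 0 := by simp [hc]
  have habel := sum_mul_eq_sub_integral_mul₀ c hc0 x hf_diff hf_int
  have hlhs : ∑ k ∈ Finset.Icc 0 ⌊x⌋₊, f k * c k = ∑ n ∈ Finset.Icc 1 ⌊x⌋₊, (Λ n : ℝ) / n := by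
    rw [Finset.Icc_eq_cons_Ioc (Nat.zero_le _), Finset.sum_cons, hc0, mul_zero, zero_add,
      show Finset.Icc 1 ⌊x⌋₊ = Finset.Ioc 0 ⌊x⌋₊ from Finset.Icc_add_one_left_eq_Ioc 0 ⌊x⌋₊]
    refine Finset.sum_congr rfl fun k _ => ?_
    rw [hf, hc, div_eq_inv_mul]
  have hint : ∫ t in Set.Ioc 1 x, deriv f t * ∑ k ∈ Finset.Icc 0 ⌊t⌋₊, c k =
      -∫ t in Ioc 1 x, ψ t / t ^ 2 := by
    rw [← integral_neg]
    refine setIntegral_congr_fun measurableSet_Ioc fun t ht ↦ ?_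
    rw [hderiv_eq t (Set.Ioc_subset_Icc_self ht), hS]
    ring
  rw [hlhs, hS, hint] at habel
  -- `habel : Σ = f x * ψ x - -∫_1^x ψ/t²`; now split `ψ/t² = (ψ − t)/t² + 1/t`
  have hI := RosserSchoenfeld.integrableOn_psi_sub_self_div_sq
  have hsplitIoi : ∫ t in Ioi 1, (ψ t - t) / t ^ 2 =
      (∫ t in Ioc 1 x, (ψ t - t) / t ^ 2) + ∫ t in Ioi x, (ψ t - t) / t ^ 2 := by
    rw [← setIntegral_union (Set.Ioc_disjoint_Ioi le_rfl) measurableSet_Ioi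
      (hI.mono_set Ioc_subset_Ioi_self) (hI.mono_set (Ioi_subset_Ioi hx.le)),
      Ioc_union_Ioi_eq_Ioi hx.le]
  rw [RosserSchoenfeld.integral_Ioi_psi_sub_self_div_sq] at hsplitIoi
  have h1 : IntegrableOn (fun t : ℝ ↦ t⁻¹) (Ioc 1 x) := by
    refine ((continuousOn_inv₀ (G₀ := ℝ)).mono ?_).integrableOn_Icc.mono_set Set.Ioc_subset_Icc_self
    intro t ht
    exact Set.mem_compl_singleton_iff.mpr (show (0 : ℝ) < t by linarith [ht.1]).ne'
  have hsplit : ∀ t ∈ Ioc 1 x, ψ t / t ^ 2 = (ψ t - t) / t ^ 2 + t⁻¹ := by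
    intro t ht
    have ht0 : t ≠ 0 := by linarith [ht.1]
    field_simp
    ring
  have hIoc : ∫ t in Ioc 1 x, ψ t / t ^ 2 = (∫ t in Ioc 1 x, (ψ t - t) / t ^ 2) + Real.log x := by
    rw [setIntegral_congr_fun measurableSet_Ioc hsplit,
      integral_add (hI.mono_set Ioc_subset_Ioi_self) h1]
    have hinv : ∫ t in Ioc 1 x, t⁻¹ = Real.log x := by
      rw [← intervalIntegral.integral_of_le hx.le, integral_inv (by
        rw [Set.uIcc_of_le hx.le]; intro h0; exact absurd h0.1 (by norm_num)), div_one]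
    rw [hinv]
  have hfx : f x * ψ x = (ψ x - x) / x + 1 := by
    rw [hf]
    field_simp
    ring
  rw [habel, hfx, hIoc]
  linarith

/-- **The explicit two-sided bound for the Mertens remainder** (hypothesis-free): for `x ≥ 9`,
`|Σ_{n ≤ x} Λ(n)/n − log x + γ| ≤ 0.00862 + 5.7663/√x + (1.838 + log 2π)/x + 1/(2x(x²−1)) + 2.72/2516`
(`|ψ(x) − x|/x ≤ 0.00862 + 5.72/√x + 1.838/x`; Lemma 7: `|∫_x^∞ (ψ − t)t⁻²| ≤ K(x) + log(2π)/x + 1/(2x(x²−1))`;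
`K(x) ≤ x^{−1/2}·0.0463 + 2G(2516)`, `2G(2516) ≤ 0.34·log 2516/2516 ≤ 2.72/2516`).
[cite: RosserSchoenfeld1962, Lemma 7 and (4.21)] -/
theorem abs_mertensE1_le_explicit_w1a2 {x : ℝ} (hx : 9 ≤ x) :
    |(∑ n ∈ Finset.Icc 1 ⌊x⌋₊, (Λ n : ℝ) / n) - Real.log x + Real.eulerMascheroniConstant| ≤
      0.00862 + 5.7663 / Real.sqrt x + (1.838 + Real.log (2 * π)) / x
        + 1 / (2 * x * (x ^ 2 - 1)) + 2.72 / 2516 := by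
  have hx1 : 1 < x := by linarith
  have hx0 : 0 < x := by linarith
  have hsx : 0 < Real.sqrt x := Real.sqrt_pos.2 hx0
  rw [mertensE1_eq_boundary_sub_tail_w1a2 hx1]
  -- the boundary term
  have hψ := PsiFromZeros2516.abs_psi_sub_self_le hx
  have hB : |(ψ x - x) / x| ≤ 0.00862 + 5.72 / Real.sqrt x + 1.838 / x := by
    rw [abs_div, abs_of_pos hx0, div_le_iff₀ hx0]
    have hsq : Real.sqrt x * Real.sqrt x = x := Real.mul_self_sqrt hx0.le
    have e2 : (0.00862 + 5.72 / Real.sqrt x + 1.838 / x) * x =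
        0.00862 * x + 5.72 * Real.sqrt x + 1.838 := by
      field_simp
      nlinarith [hsq]
    rw [e2]
    exact hψ
  -- the tail integral
  have hInt := PsiTailIntegral.abs_integral_Ioi_psi_sub_self_div_sq_le hx1
  have hK := PsiTailIntegral.rsK_le_of_inStripUpTo riemannHypothesisInStripUpTo_2516 hx1.le
  have htail : PsiTailIntegral.tailInvNormProd 2516 ≤ 2 * SchoenfeldBound.Gtail 2516 :=
    ZetaZeroTails.tailInvNormProd_le le_rfl
  have hG : SchoenfeldBound.Gtail 2516 ≤ 0.17 * Real.log 2516 / 2516 :=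
    ZetaZeroTails.Gtail_le le_rfl
  -- `log 2516 ≤ 8` (`2516 ≤ 2.7182818283⁸ ≤ e⁸`)
  have hL : Real.log 2516 ≤ 8 := by
    rw [Real.log_le_iff_le_exp (by norm_num)]
    have h1 : (2.7182818283 : ℝ) < Real.exp 1 := Real.exp_one_gt_d9
    have h8 : Real.exp 8 = Real.exp 1 ^ 8 := by rw [← Real.exp_nat_mul]; norm_num
    rw [h8]
    have h2 : (2516 : ℝ) ≤ (2.7182818283 : ℝ) ^ 8 := by norm_num
    exact h2.trans (pow_le_pow_left₀ (by norm_num) h1.le 8)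
  have hSq : SchoenfeldBound.sumInvNormSq 2516 ≤ 0.0463 := sum_zeroOrder_div_norm_sq_le _
  have hrpow : x ^ (-(1 / 2 : ℝ)) = 1 / Real.sqrt x := by
    rw [Real.sqrt_eq_rpow, Real.rpow_neg hx0.le, inv_eq_one_div]
  rw [hrpow] at hK
  have hK' : PsiTailIntegral.rsK x ≤ 0.0463 / Real.sqrt x + 2.72 / 2516 := by
    have h1 : 1 / Real.sqrt x * SchoenfeldBound.sumInvNormSq 2516 ≤ 1 / Real.sqrt x * 0.0463 :=
      mul_le_mul_of_nonneg_left hSq (by positivity)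
    have h2 : 1 / Real.sqrt x * 0.0463 = 0.0463 / Real.sqrt x := by ring
    have h3 : 2 * SchoenfeldBound.Gtail 2516 ≤ 2.72 / 2516 := by
      have : 0.17 * Real.log 2516 / 2516 ≤ 0.17 * 8 / 2516 :=
        div_le_div_of_nonneg_right (by nlinarith) (by norm_num)
      linarith
    linarith
  have hT : |∫ t in Ioi x, (ψ t - t) / t ^ 2| ≤
      0.0463 / Real.sqrt x + 2.72 / 2516 + Real.log (2 * π) / x + 1 / (2 * x * (x ^ 2 - 1)) := by
    linarith
  have hsum : 5.72 / Real.sqrt x + 0.0463 / Real.sqrt x = 5.7663 / Real.sqrt x := by ring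
  have hdiv : 1.838 / x + Real.log (2 * π) / x = (1.838 + Real.log (2 * π)) / x := by ring
  calc |(ψ x - x) / x - ∫ t in Ioi x, (ψ t - t) / t ^ 2|
      ≤ |(ψ x - x) / x| + |∫ t in Ioi x, (ψ t - t) / t ^ 2| := abs_sub _ _
    _ ≤ (0.00862 + 5.72 / Real.sqrt x + 1.838 / x) +
          (0.0463 / Real.sqrt x + 2.72 / 2516 + Real.log (2 * π) / x
            + 1 / (2 * x * (x ^ 2 - 1))) := add_le_add hB hT
    _ = 0.00862 + 5.7663 / Real.sqrt x + (1.838 + Real.log (2 * π)) / x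
          + 1 / (2 * x * (x ^ 2 - 1)) + 2.72 / 2516 := by
        rw [← hsum, ← hdiv]; ring

/-- **Stub `stub_mertensE1` (plan id A2 "MertensConst"; registered on crux
stmt-RiemannHypothesis-11229, line `Sketch`)**: the two-sided Mertens remainder bound
`|Σ_{n ≤ x} Λ(n)/n − log x + γ| ≤ 1/40` for all real `x ≥ 442439`, hypothesis-free (numerically the
left side is `≤ 0.0185` there: `√x ≥ 665`, `log 2π ≤ 1.8379`, `log 2516 ≤ 8`).
[cite: RosserSchoenfeld1962, Thm. 6 and Lemma 7] -/
theorem stub_mertensE1 : ∀ x : ℝ, 442439 ≤ x → |(∑ n ∈ Finset.Icc 1 ⌊x⌋₊, (ArithmeticFunction.vonMangoldt n : ℝ) / n) - Real.log x + Real.eulerMascheroniConstant| ≤ 1 / 40 := by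
  intro x hx
  have h := abs_mertensE1_le_explicit_w1a2 (show (9 : ℝ) ≤ x by linarith)
  have hx0 : 0 < x := by linarith
  have hs : (665 : ℝ) ≤ Real.sqrt x := by
    rw [show (665 : ℝ) = Real.sqrt (665 ^ 2) by rw [Real.sqrt_sq (by norm_num)]]
    exact Real.sqrt_le_sqrt (by nlinarith)
  have h1 : 5.7663 / Real.sqrt x ≤ 5.7663 / 665 :=
    div_le_div_of_nonneg_left (by norm_num) (by norm_num) hs
  have hl2pi := SchoenfeldMid.log_two_pi_le
  have h2 : (1.838 + Real.log (2 * π)) / x ≤ (1.838 + 1.8379) / 442439 := by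
    have hnum : 0 ≤ 1.838 + Real.log (2 * π) := by
      have : 0 ≤ Real.log (2 * π) := Real.log_nonneg (by linarith [Real.pi_gt_three])
      linarith
    calc (1.838 + Real.log (2 * π)) / x ≤ (1.838 + Real.log (2 * π)) / 442439 :=
          div_le_div_of_nonneg_left hnum (by norm_num) hx
      _ ≤ (1.838 + 1.8379) / 442439 := by
          apply div_le_div_of_nonneg_right _ (by norm_num); linarith
  have h3 : 1 / (2 * x * (x ^ 2 - 1)) ≤ 1 / (2 * 442439 * (442439 ^ 2 - 1)) := by
    apply div_le_div_of_nonneg_left (by norm_num) (by norm_num)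
    have hx2 : (442439 : ℝ) ^ 2 ≤ x ^ 2 := by nlinarith
    nlinarith
  have hnum : (0.00862 : ℝ) + 5.7663 / 665 + (1.838 + 1.8379) / 442439
      + 1 / (2 * 442439 * (442439 ^ 2 - 1)) + 2.72 / 2516 ≤ 1 / 40 := by norm_num
  linarith

end Summit.RiemannHypothesis.RiemannHypothesis.Theorems.WeilCombBohrFejer

end
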